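import Mathlib.Algebra.Order.BigOperators.Ring.Finset
import Mathlib.Algebra.BigOperators.Ring.Finset
import Mathlib.Data.Real.Basic
import Mathlib.Tactic.Linarith
import Mathlib.Tactic.Ring
import HarnessLib

/-!
# The ONE-STEP LEMMA of the product form (P) — I: boundary systems (Sahi programme, prover prim-sahi-p2 gen 59)

Support file (`--supports stmt-CriticalPhenomena-4575`, helper).  Standard axioms, no sorries, no named facts, no definitions.
Memo `run/shared/lean/prim/prim-sahi/FROM-prim-sahi-p2-gen59-ONE-STEP-LEMMA.md`, `prim-sahi-p2/PROOF-E3.md` §69.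

CONTEXT.  CONJECTURE (P) of the fibre language (gens 53–58): in every two-copy fibre `(H; s, a, c)` of a finite multigraph,
`#bad² ≤ #P1 · #P2`.  On the class `𝒯 = {H : H − {s,c} acyclic}` the all-configuration counts obey a per-vertex product recursion
(gen 58, PROOF-E3 (68j)) and (P) at a vertex is the ONE-STEP LEMMA: for independent children `i` with outcome weights
`(a_i, b_i, d_i, n_i) ≥ 0`, `d_i² ≤ a_i b_i`, `d_i ≤ n_i`, writing `σ = a+b+d+n`,
`f := ∏ σ − ∏ (b+n) − ∏ (a+n) + ∏ n`, `A := ∏ (σ+a) − ∏ σ`, `B := ∏ (σ+b) − ∏ σ`, one has `f² ≤ A·B`.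

THIS FILE proves the BOUNDARY case, on which everything rests: a boundary child has `(a, b, d, n) = (u², w², uw, uw)` (so `d² = ab`,
`d = n`).  With `s_i = u_i + w_i`, `S = ∏ s`, `U = ∏ u`, `W = ∏ w` the three quantities are
`f = (S − U)(S − W)`, `A = ∏ (s² + u²) − S²`, `B = ∏ (s² + w²) − S²`, and the proof is ONE Cauchy–Schwarz inequality:
expanding `S = ∏ (u_i + w_i) = Σ_T u^T w^{W∖T}` (`Finset.prod_add`),
`f = S·(S − U − W) + U·W = Σ_{∅ ≠ T ⊊ W} (u^T s^{W∖T})·(w^{W∖T} s^T) + (u^W)·(w^W) = Σ_{T ≠ ∅} x_T · y_{π T}`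
with `x_T = u^T s^{W∖T}`, `y_T = w^T s^{W∖T}` and the bijection `π : T ↦ W∖T (T ≠ W), W ↦ W` of the nonempty subsets, while
`Σ_{T≠∅} x_T² = A` and `Σ_{T≠∅} y_T² = B` EXACTLY (again `Finset.prod_add`).  No sign hypotheses are needed.
* `boundary_productForm` — `((S−U)(S−W))² ≤ A·B` (unmarked parent);
* `boundary_productForm_marked` — `(S(S−U))² ≤ (A + S²)·B` (parent joined to `s`), and its mirror `boundary_productForm_marked'`.
The general lemma (every admissible child is a nonnegative combination of boundary children and a null child; multilinearity; a second
Cauchy–Schwarz) is the companion file `…ThreePointProductFormOneStep`.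
[this work] (gen 59); [folklore] (Cauchy–Schwarz `Finset.sum_mul_sq_le_sq_mul_sq`, binomial expansion `Finset.prod_add`).
-/

namespace Summit.CriticalPhenomena.PercolationContinuityZ3.Theorems.ProductFormOneStep

open Finset

variable {ι : Type*} [DecidableEq ι]

/-! ### 1. Bookkeeping on the powerset -/

/-- Splitting a sum over the powerset of a nonempty `W` into the terms `T = ∅`, `T = W` and the proper nonempty subsets. [folklore] -/
theorem sum_powerset_split (W : Finset ι) (hW : W.Nonempty) (g : Finset ι → ℝ) :
    ∑ T ∈ W.powerset, g T = g ∅ + g W + ∑ T ∈ (W.powerset.erase ∅).erase W, g T := by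
  have h0 : (∅ : Finset ι) ∈ W.powerset := Finset.empty_mem_powerset W
  have hW' : W ∈ W.powerset.erase ∅ := by
    rw [Finset.mem_erase]
    exact ⟨hW.ne_empty, Finset.mem_powerset_self W⟩
  rw [← Finset.sum_erase_add _ _ h0, ← Finset.sum_erase_add _ _ hW']
  ring

/-- The sum over the nonempty subsets, split off the term `T = W`. [folklore] -/
theorem sum_powerset_erase_empty_split (W : Finset ι) (hW : W.Nonempty) (g : Finset ι → ℝ) :
    ∑ T ∈ W.powerset.erase ∅, g T = g W + ∑ T ∈ (W.powerset.erase ∅).erase W, g T := by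
  have hW' : W ∈ W.powerset.erase ∅ := by
    rw [Finset.mem_erase]
    exact ⟨hW.ne_empty, Finset.mem_powerset_self W⟩
  rw [← Finset.sum_erase_add _ _ hW']
  ring

/-- The sum over the subsets other than `W`, split off the term `T = ∅`. [folklore] -/
theorem sum_powerset_erase_top_split (W : Finset ι) (hW : W.Nonempty) (g : Finset ι → ℝ) :
    ∑ T ∈ W.powerset.erase W, g T = g ∅ + ∑ T ∈ (W.powerset.erase ∅).erase W, g T := by
  have h0 : (∅ : Finset ι) ∈ W.powerset.erase W := by
    rw [Finset.mem_erase]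
    exact ⟨fun h => hW.ne_empty h.symm, Finset.empty_mem_powerset W⟩
  rw [← Finset.sum_erase_add _ _ h0, Finset.erase_right_comm]
  ring

/-- `∏_{W∖T} f · ∏_T f = ∏_W f` for `T` in the powerset. [folklore] -/
theorem prod_sdiff_mul_prod_of_mem_powerset {W T : Finset ι} (hT : T ∈ W.powerset) (f : ι → ℝ) :
    (∏ i ∈ W \ T, f i) * ∏ i ∈ T, f i = ∏ i ∈ W, f i :=
  Finset.prod_sdiff (Finset.mem_powerset.mp hT)

/-! ### 2. The boundary lemma -/

/-- **BOUNDARY CASE OF THE ONE-STEP LEMMA.**  For all real `u, w : ι → ℝ` and every finite `W`, with `s_i = u_i + w_i`: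
`((∏ s² − ∏ w·s − ∏ u·s + ∏ u·w))² ≤ (∏ (s² + u²) − ∏ s²) · (∏ (s² + w²) − ∏ s²)`, i.e. `((S−U)(S−W))² ≤ A·B`.
One Cauchy–Schwarz step on the nonempty subsets of `W` after the binomial expansion `S = Σ_T u^T w^{W∖T}`. [this work] -/
theorem boundary_productForm (W : Finset ι) (u w : ι → ℝ) :
    ((∏ i ∈ W, (u i + w i) ^ 2) - (∏ i ∈ W, w i * (u i + w i)) - (∏ i ∈ W, u i * (u i + w i)) + ∏ i ∈ W, u i * w i) ^ 2 ≤
    ((∏ i ∈ W, ((u i + w i) ^ 2 + u i ^ 2)) - ∏ i ∈ W, (u i + w i) ^ 2) *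
    ((∏ i ∈ W, ((u i + w i) ^ 2 + w i ^ 2)) - ∏ i ∈ W, (u i + w i) ^ 2) := by
  rcases W.eq_empty_or_nonempty with hW | hW
  · subst hW; simp
  -- abbreviations
  set S := ∏ i ∈ W, (u i + w i) with hS
  set U := ∏ i ∈ W, u i with hU
  set V := ∏ i ∈ W, w i with hV
  -- the two families and the pairing
  set x : Finset ι → ℝ := fun T => (∏ i ∈ T, u i) * ∏ i ∈ W \ T, (u i + w i) with hx
  set y : Finset ι → ℝ := fun T =>
    if T = W then ∏ i ∈ W, w i else (∏ i ∈ W \ T, w i) * ∏ i ∈ T, (u i + w i) with hy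
  -- binomial expansions
  have hSexp : S = ∑ T ∈ W.powerset, (∏ i ∈ T, u i) * ∏ i ∈ W \ T, w i := Finset.prod_add u w W
  have hAexp : ∏ i ∈ W, ((u i + w i) ^ 2 + u i ^ 2) =
      ∑ T ∈ W.powerset, (∏ i ∈ T, u i ^ 2) * ∏ i ∈ W \ T, (u i + w i) ^ 2 := by
    rw [← Finset.prod_add]
    exact Finset.prod_congr rfl fun i _ => by ring
  have hBexp : ∏ i ∈ W, ((u i + w i) ^ 2 + w i ^ 2) =
      ∑ T ∈ W.powerset, (∏ i ∈ T, (u i + w i) ^ 2) * ∏ i ∈ W \ T, w i ^ 2 := Finset.prod_add _ _ W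
  -- rewrite the left-hand side products
  have hWS : ∏ i ∈ W, w i * (u i + w i) = V * S := by rw [Finset.prod_mul_distrib]
  have hUS : ∏ i ∈ W, u i * (u i + w i) = U * S := by rw [Finset.prod_mul_distrib]
  have hUW : ∏ i ∈ W, u i * w i = U * V := by rw [Finset.prod_mul_distrib]
  have hS2 : ∏ i ∈ W, (u i + w i) ^ 2 = S ^ 2 := Finset.prod_pow W 2 _
  -- (i) f = Σ_{T ≠ ∅} x_T y_T
  have hf : S ^ 2 - V * S - U * S + U * V = ∑ T ∈ W.powerset.erase ∅, x T * y T := by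
    -- S - U - V = Σ over proper nonempty subsets of u^T w^{W \ T}
    have h1 : S - U - V = ∑ T ∈ (W.powerset.erase ∅).erase W, (∏ i ∈ T, u i) * ∏ i ∈ W \ T, w i := by
      rw [hSexp, sum_powerset_split W hW]
      simp only [Finset.prod_empty, one_mul, Finset.sdiff_empty, Finset.sdiff_self, mul_one]
      rw [hU, hV]; ring
    rw [sum_powerset_erase_empty_split W hW]
    have hyW : y W = V := by simp only [hy, if_true]; rw [hV]
    have hxW : x W = U := by simp only [hx, Finset.sdiff_self, Finset.prod_empty, mul_one]; rw [hU]
    rw [hxW, hyW]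
    have h2 : ∑ T ∈ (W.powerset.erase ∅).erase W, x T * y T =
        S * ∑ T ∈ (W.powerset.erase ∅).erase W, (∏ i ∈ T, u i) * ∏ i ∈ W \ T, w i := by
      rw [Finset.mul_sum]
      refine Finset.sum_congr rfl fun T hT => ?_
      have hTW : T ≠ W := (Finset.mem_erase.mp hT).1
      have hTp : T ∈ W.powerset := (Finset.mem_erase.mp (Finset.mem_erase.mp hT).2).2
      simp only [hx, hy, hTW, if_false]
      have hsplit := prod_sdiff_mul_prod_of_mem_powerset hTp (fun i => u i + w i)
      rw [← hS] at hsplit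
      calc (∏ i ∈ T, u i) * (∏ i ∈ W \ T, (u i + w i)) * ((∏ i ∈ W \ T, w i) * ∏ i ∈ T, (u i + w i))
          = ((∏ i ∈ W \ T, (u i + w i)) * ∏ i ∈ T, (u i + w i)) * ((∏ i ∈ T, u i) * ∏ i ∈ W \ T, w i) := by ring
        _ = S * ((∏ i ∈ T, u i) * ∏ i ∈ W \ T, w i) := by rw [hsplit]
    rw [h2, ← h1]; ring
  -- (ii) A = Σ_{T ≠ ∅} x_T²
  have hA : (∏ i ∈ W, ((u i + w i) ^ 2 + u i ^ 2)) - S ^ 2 = ∑ T ∈ W.powerset.erase ∅, x T ^ 2 := by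
    have h0 : (∅ : Finset ι) ∈ W.powerset := Finset.empty_mem_powerset W
    rw [hAexp, ← Finset.sum_erase_add _ _ h0]
    simp only [Finset.prod_empty, one_mul, Finset.sdiff_empty]
    rw [hS2]
    have : ∑ T ∈ W.powerset.erase ∅, x T ^ 2 = ∑ T ∈ W.powerset.erase ∅, (∏ i ∈ T, u i ^ 2) * ∏ i ∈ W \ T, (u i + w i) ^ 2 := by
      refine Finset.sum_congr rfl fun T _ => ?_
      simp only [hx]; rw [mul_pow, Finset.prod_pow, Finset.prod_pow]
    rw [this]; ring
  -- (iii) B = Σ_{T ≠ ∅} y_T²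
  have hB : (∏ i ∈ W, ((u i + w i) ^ 2 + w i ^ 2)) - S ^ 2 = ∑ T ∈ W.powerset.erase ∅, y T ^ 2 := by
    have hW' : W ∈ W.powerset := Finset.mem_powerset_self W
    rw [hBexp, ← Finset.sum_erase_add _ _ hW']
    simp only [Finset.sdiff_self, Finset.prod_empty, mul_one]
    rw [hS2, sum_powerset_erase_top_split W hW, sum_powerset_erase_empty_split W hW]
    simp only [Finset.prod_empty, one_mul, Finset.sdiff_empty]
    have hyW : y W = V := by simp only [hy, if_true]; rw [hV]
    have hV2 : ∏ i ∈ W, w i ^ 2 = V ^ 2 := by rw [hV]; exact Finset.prod_pow W 2 _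
    rw [hyW, hV2]
    have : ∑ T ∈ (W.powerset.erase ∅).erase W, y T ^ 2 =
        ∑ T ∈ (W.powerset.erase ∅).erase W, (∏ i ∈ T, (u i + w i) ^ 2) * ∏ i ∈ W \ T, w i ^ 2 := by
      refine Finset.sum_congr rfl fun T hT => ?_
      have hTW : T ≠ W := (Finset.mem_erase.mp hT).1
      simp only [hy, hTW, if_false]; rw [mul_pow, Finset.prod_pow, Finset.prod_pow]; ring
    rw [this]; ring
  -- Cauchy–Schwarz
  rw [hWS, hUS, hUW, hS2, hf, hA, hB]
  exact Finset.sum_mul_sq_le_sq_mul_sq _ x y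

/-- **BOUNDARY CASE, PARENT JOINED TO `s`.**  `(∏ s² − ∏ u·s)² ≤ ∏ (s² + u²) · (∏ (s² + w²) − ∏ s²)`, i.e. `(S(S−U))² ≤ (A + S²)·B`:
Cauchy–Schwarz on the subsets `T ≠ W` with `S(S − U) = Σ_{T≠W} (u^T s^{W∖T})(w^{W∖T} s^T)`. [this work] -/
theorem boundary_productForm_marked (W : Finset ι) (u w : ι → ℝ) :
    ((∏ i ∈ W, (u i + w i) ^ 2) - ∏ i ∈ W, u i * (u i + w i)) ^ 2 ≤
    (∏ i ∈ W, ((u i + w i) ^ 2 + u i ^ 2)) *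
    ((∏ i ∈ W, ((u i + w i) ^ 2 + w i ^ 2)) - ∏ i ∈ W, (u i + w i) ^ 2) := by
  rcases W.eq_empty_or_nonempty with hW | hW
  · subst hW; simp
  set S := ∏ i ∈ W, (u i + w i) with hS
  set U := ∏ i ∈ W, u i with hU
  set x : Finset ι → ℝ := fun T => (∏ i ∈ T, u i) * ∏ i ∈ W \ T, (u i + w i) with hx
  set y : Finset ι → ℝ := fun T => (∏ i ∈ W \ T, w i) * ∏ i ∈ T, (u i + w i) with hy
  have hSexp : S = ∑ T ∈ W.powerset, (∏ i ∈ T, u i) * ∏ i ∈ W \ T, w i := Finset.prod_add u w W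
  have hAexp : ∏ i ∈ W, ((u i + w i) ^ 2 + u i ^ 2) =
      ∑ T ∈ W.powerset, (∏ i ∈ T, u i ^ 2) * ∏ i ∈ W \ T, (u i + w i) ^ 2 := by
    rw [← Finset.prod_add]
    exact Finset.prod_congr rfl fun i _ => by ring
  have hBexp : ∏ i ∈ W, ((u i + w i) ^ 2 + w i ^ 2) =
      ∑ T ∈ W.powerset, (∏ i ∈ T, (u i + w i) ^ 2) * ∏ i ∈ W \ T, w i ^ 2 := Finset.prod_add _ _ W
  have hUS : ∏ i ∈ W, u i * (u i + w i) = U * S := by rw [Finset.prod_mul_distrib]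
  have hS2 : ∏ i ∈ W, (u i + w i) ^ 2 = S ^ 2 := Finset.prod_pow W 2 _
  have hW' : W ∈ W.powerset := Finset.mem_powerset_self W
  -- (i) S(S-U) = Σ_{T ≠ W} x_T y_T
  have hf : S ^ 2 - U * S = ∑ T ∈ W.powerset.erase W, x T * y T := by
    have h1 : S - U = ∑ T ∈ W.powerset.erase W, (∏ i ∈ T, u i) * ∏ i ∈ W \ T, w i := by
      rw [hSexp, ← Finset.sum_erase_add _ _ hW']
      simp only [Finset.sdiff_self, Finset.prod_empty, mul_one]
      rw [hU]; ring
    have h2 : ∑ T ∈ W.powerset.erase W, x T * y T =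
        S * ∑ T ∈ W.powerset.erase W, (∏ i ∈ T, u i) * ∏ i ∈ W \ T, w i := by
      rw [Finset.mul_sum]
      refine Finset.sum_congr rfl fun T hT => ?_
      have hTp : T ∈ W.powerset := (Finset.mem_erase.mp hT).2
      simp only [hx, hy]
      have hsplit := prod_sdiff_mul_prod_of_mem_powerset hTp (fun i => u i + w i)
      rw [← hS] at hsplit
      calc (∏ i ∈ T, u i) * (∏ i ∈ W \ T, (u i + w i)) * ((∏ i ∈ W \ T, w i) * ∏ i ∈ T, (u i + w i))
          = ((∏ i ∈ W \ T, (u i + w i)) * ∏ i ∈ T, (u i + w i)) * ((∏ i ∈ T, u i) * ∏ i ∈ W \ T, w i) := by ring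
        _ = S * ((∏ i ∈ T, u i) * ∏ i ∈ W \ T, w i) := by rw [hsplit]
    rw [h2, ← h1]; ring
  -- (ii) Σ_{T ≠ W} x_T² ≤ A + S²
  have hA : ∑ T ∈ W.powerset.erase W, x T ^ 2 ≤ ∏ i ∈ W, ((u i + w i) ^ 2 + u i ^ 2) := by
    have : ∏ i ∈ W, ((u i + w i) ^ 2 + u i ^ 2) = ∑ T ∈ W.powerset, x T ^ 2 := by
      rw [hAexp]
      refine Finset.sum_congr rfl fun T _ => ?_
      simp only [hx]; rw [mul_pow, Finset.prod_pow, Finset.prod_pow]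
    rw [this, ← Finset.sum_erase_add _ _ hW']
    have : 0 ≤ x W ^ 2 := sq_nonneg _
    linarith
  -- (iii) B = Σ_{T ≠ W} y_T²
  have hB : (∏ i ∈ W, ((u i + w i) ^ 2 + w i ^ 2)) - S ^ 2 = ∑ T ∈ W.powerset.erase W, y T ^ 2 := by
    rw [hBexp, ← Finset.sum_erase_add _ _ hW']
    simp only [Finset.sdiff_self, Finset.prod_empty, mul_one]
    rw [hS2]
    have : ∑ T ∈ W.powerset.erase W, y T ^ 2 =
        ∑ T ∈ W.powerset.erase W, (∏ i ∈ T, (u i + w i) ^ 2) * ∏ i ∈ W \ T, w i ^ 2 := by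
      refine Finset.sum_congr rfl fun T _ => ?_
      simp only [hy]; rw [mul_pow, Finset.prod_pow, Finset.prod_pow]; ring
    rw [this]; ring
  have hBnn : 0 ≤ (∏ i ∈ W, ((u i + w i) ^ 2 + w i ^ 2)) - S ^ 2 := by
    rw [hB]; exact Finset.sum_nonneg fun T _ => sq_nonneg _
  rw [hUS, hS2, hf]
  calc (∑ T ∈ W.powerset.erase W, x T * y T) ^ 2
      ≤ (∑ T ∈ W.powerset.erase W, x T ^ 2) * ∑ T ∈ W.powerset.erase W, y T ^ 2 :=
        Finset.sum_mul_sq_le_sq_mul_sq _ x y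
    _ ≤ (∏ i ∈ W, ((u i + w i) ^ 2 + u i ^ 2)) * ∑ T ∈ W.powerset.erase W, y T ^ 2 :=
        mul_le_mul_of_nonneg_right hA (by rw [← hB]; exact hBnn)
    _ = _ := by rw [hB]

/-- **BOUNDARY CASE, PARENT JOINED TO `c`** (mirror image: `u ↔ w`).  `(∏ s² − ∏ w·s)² ≤ (∏ (s² + u²) − ∏ s²) · ∏ (s² + w²)`. [this work] -/
theorem boundary_productForm_marked' (W : Finset ι) (u w : ι → ℝ) :
    ((∏ i ∈ W, (u i + w i) ^ 2) - ∏ i ∈ W, w i * (u i + w i)) ^ 2 ≤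
    ((∏ i ∈ W, ((u i + w i) ^ 2 + u i ^ 2)) - ∏ i ∈ W, (u i + w i) ^ 2) *
    (∏ i ∈ W, ((u i + w i) ^ 2 + w i ^ 2)) := by
  have h := boundary_productForm_marked W w u
  have e1 : ∀ i, w i + u i = u i + w i := fun i => add_comm _ _
  simp only [e1] at h
  rw [mul_comm]
  exact h

end Summit.CriticalPhenomena.PercolationContinuityZ3.Theorems.ProductFormOneStep
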